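import Summits.BirchSwinnertonDyer.BirchSwinnertonDyer.Theorems.ManinLocalTwoThreeManinOddAtFourDyadicTwistConductor
import Summits.BirchSwinnertonDyer.BirchSwinnertonDyer.Theorems.ManinLocalTwoThreeOddUntwistReductions
import Literature.NumberTheory.EllipticCurves.ManinConstantQuadraticTwistAtTwoProofs
import HarnessLib

/-!
# Route `ManinLocalTwoThree`, crux C3 `ManinPrimeToThreeAtNine` (stmt-BirchSwinnertonDyer-22968): DYADIC
# untwisting of the C3 core (Stevens' `η = 1` at `2`) and C3 ⟸ its fully twist-minimal core

Sequel of `ManinLocalTwoThreeOddUntwistReductions.lean`. There the twist-minimal stub of C3 was reduced to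
the classes with no ternary and no odd (`q ≠ 3`) semistable untwist. Here the remaining single-prime
untwists — the DYADIC ones, `W ∼ W' ⊗ ℚ(√d)`, `d ∈ {−1, 2, −2}`, `W` additive at `2`, `W'` semistable at
`2`, in Stevens' case `η = 1` (`d = −1`, or `W'` multiplicative at `2`) — are removed as well:
* `maninLocalTwoThree_not_dvd_maninConstant_of_dyadicUntwist` — transport of `p ∤ c` (ANY prime `p`)
  down such an untwist, granted only modularity: the body of the tree's
  `not_dvd_maninConstant_of_isTwistOfSemistableAtTwo_gamma0_of_char` (Stevens (5.2) at `2` PROVED there as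
  `neronLattice_quadraticTwist_two`) run to the divisibility `c(D) ∣ c(D')`
  (`maninConstant_dvd_of_charTwist_gamma0`) instead of Česnavičius at `2`; the conductor side conditions
  come from the landed `stub_dyadicTwistConductor`;
* `maninLocalTwoThree_twistMinimalAtThree_of_fullUntwistMinimal` — the birth stub
  `stub_twistMinimalAtThree` ⟸ its restriction to the classes with no ternary, no odd (`q ≠ 3`) and no
  dyadic-`η = 1` semistable untwist (strong induction on the level; `f₃` and ternary twist-minimality
  are inherited by the dyadic partner since `χ_d` is unramified at `3`);
* `maninLocalTwoThree_maninPrimeToThreeAtNine_of_fullUntwistMinimal` — **C3 ⟸ that core alone**.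
The `η = 2` dyadic untwists (`d = ±2`, partner good supersingular at `2`) are not removed here. Nothing
here proves BSD or Manin's conjecture at `3`. Seat bsd-line-manin23-p2. References: [Stevens1989] Lemmas
(5.2), (5.4); [Pal2012] Prop. 2.4, Lemma 3.1; [Cesnavicius2018] Thm. 1.2; [SilvermanATAEC1994] IV.9.4.
-/

set_option autoImplicit false
set_option linter.dupNamespace false

noncomputable section

open scoped Classical NumberField

namespace Summit.BirchSwinnertonDyer.BirchSwinnertonDyer.Theorems

open WeierstrassCurve IsDedekindDomain IsDedekindDomain.HeightOneSpectrum Rat.HeightOneSpectrum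
  Literature.NumberTheory.Automorphic
  Literature.NumberTheory.EllipticCurves Literature.NumberTheory.EllipticCurves.ModularForms

/-! ## §1 Transport of `p ∤ c` down a dyadic `η = 1` untwist -/

/-- Generic-character core of the dyadic transport (the tree's `…AtTwo_gamma0_of_char`, ending in the
divisibility `c(D) ∣ c(D')`). [cite: Stevens1989, Lemmas (5.2), (5.4)] [cite: Pal2012, Lemma 3.1] -/
theorem maninLocalTwoThree_not_dvd_maninConstant_of_dyadicUntwist_of_char
    (hnf : exists_isNewformOf)
    {W : WeierstrassCurve ℚ} [W.IsElliptic] [W.IsGloballyMinimal] {N : ℕ} [NeZero N]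
    (D : ModularParametrizationData W N)
    (hopt : ∀ z ∈ D.L.lattice, ∃ w ∈ periodLattice D.f, z = D.c * w)
    {W' : WeierstrassCurve ℚ} [W'.IsElliptic] [W'.IsGloballyMinimal]
    {d : ℤ} (hd : d = -1 ∨ d = 2 ∨ d = -2)
    {m : ℕ} [NeZero m] {χ : DirichletCharacter ℂ m} (hχq : χ.IsQuadratic) (hχp : χ.IsPrimitive)
    (hG : gaussSum χ (ZMod.stdAddChar (N := m)) ^ 2 = ((4 * d : ℤ) : ℂ))
    (hχodd : ∀ n : ℕ, ¬ 2 ∣ n →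
      (((W'.quadraticTwist (d : ℚ)).LFunction n : ℤ) : ℂ) = χ n * ((W'.LFunction n : ℤ) : ℂ))
    (hχeven : ∀ n : ℕ, 2 ∣ n → χ n = 0)
    (htw : IsIsogenous W (W'.quadraticTwist (d : ℚ)))
    (hN'N : W'.conductorNorm ℤ ∣ N) (hmN : m ^ 2 ∣ N)
    (h4N' : ¬ 2 ^ 2 ∣ W'.conductorNorm ℤ) (hη : d = -1 ∨ 2 ∣ W'.conductorNorm ℤ)
    (hadd : ¬ W.HasGoodReductionAtPrime 2 ∧ ¬ W.HasMultiplicativeReductionAtPrime 2) {p : ℤ}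
    (hp : ∀ (W₁ : WeierstrassCurve ℚ) [W₁.IsElliptic] [W₁.IsGloballyMinimal] {N₁ : ℕ} [NeZero N₁]
      (D₁ : ModularParametrizationData W₁ N₁), IsIsogenous W' W₁ →
      (∀ z ∈ D₁.L.lattice, ∃ w ∈ periodLattice D₁.f, z = D₁.c * w) → ¬ p ∣ D₁.maninConstant) :
    ¬ p ∣ D.maninConstant := by
  haveI : Fact (Nat.Prime 2) := ⟨Nat.prime_two⟩
  have hdZ : d ≠ 0 := by rcases hd with rfl | rfl | rfl <;> norm_num
  have hd0 : (d : ℚ) ≠ 0 := by exact_mod_cast hdZ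
  haveI : (W'.quadraticTwist (d : ℚ)).IsElliptic := W'.isElliptic_quadraticTwist hd0
  haveI : NeZero (W'.conductorNorm ℤ) := ⟨(conductorNorm_pos_holds W').ne'⟩
  -- the optimal `X₀`-datum `D'` of `𝒜'`, on a globally minimal `W₁' ∼ W'`
  obtain ⟨f', hf'⟩ := hnf W'
  obtain ⟨W₁', hE₁', hM₁', D', hD'f, hiso', hmin⟩ :=
    exists_optimal_modularParametrizationData_of_isNewformOf' (W'.conductorNorm ℤ) W' rfl hf'
  haveI := hE₁'
  haveI := hM₁'
  have hopt' : ∀ z ∈ D'.L.lattice, ∃ w ∈ periodLattice D'.f, z = D'.c * w :=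
    D'.latticeEq_of_forall_modularDegree_le fun W₂ _ D₂ h2 ↦ hmin W₂ D₂ (h2.trans hD'f)
  -- `W₁'` is semistable at `2`, multiplicative there when `2 ∣ N(W')`
  have hN'₁ : W'.conductorNorm ℤ = W₁'.conductorNorm ℤ :=
    IsNewformOf.level_eq_conductorNorm_of_exists_isNewformOf hnf D'.isNewformOf
  have hsemi : W₁'.HasGoodReductionAtPrime 2 ∨ W₁'.HasMultiplicativeReductionAtPrime 2 :=
    hasGoodReductionAtPrime_or_hasMultiplicativeReductionAtPrime_of_not_sq_dvd_conductorNorm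
      (by rw [← hN'₁]; exact h4N')
  have hη₁ : d = -1 ∨ W₁'.HasMultiplicativeReductionAtPrime 2 := by
    rcases hη with h | h2N
    · exact Or.inl h
    · right
      rcases hsemi with hg | hm'
      · exfalso
        rw [hN'₁] at h2N
        exact ((dvd_conductorNorm_iff_not_hasGoodReductionAtPrime W₁' 2).mp h2N) hg
      · exact hm'
  -- the minimal model `C` of `W₁' ⊗ χ` and a Néron pair of it
  haveI : (W₁'.quadraticTwist (d : ℚ)).IsElliptic := W₁'.isElliptic_quadraticTwist hd0
  obtain ⟨vC, hvC⟩ := hasGlobalMinimalModel_rat_holds (W₁'.quadraticTwist (d : ℚ))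
  haveI := hvC
  haveI : ((vC • W₁'.quadraticTwist (d : ℚ)).baseChange ℂ).IsElliptic := by
    rw [WeierstrassCurve.baseChange]; infer_instance
  obtain ⟨LC, hC⟩ := exists_isNeronLatticeOf_holds ((vC • W₁'.quadraticTwist (d : ℚ)).baseChange ℂ)
  -- Stevens (5.2) at `2`, `η = 1`: `Λ_C = g(χ)⁻¹ Λ_{W₁'}`
  have hLC : ∀ z : ℂ, z ∈ LC.lattice ↔ gaussSum χ (ZMod.stdAddChar (N := m)) * z ∈ D'.L.lattice :=
    fun z ↦ neronLattice_quadraticTwist_two D'.isNeronLattice hd hsemi hη₁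
      (vC • W₁'.quadraticTwist (d : ℚ)) ⟨vC, rfl⟩ hC hG z
  -- the newform of `𝒜` is the `χ`-twist of that of `𝒜'`
  have hLtw : W.LFunction = (W'.quadraticTwist (d : ℚ)).LFunction :=
    LFunction_eq_of_isIsogenous_holds _ _ htw
  have hf : ∀ n : ℕ, cuspCoeff D.f n = χ n * cuspCoeff D'.f n := by
    intro n
    rw [D.isNewformOf.2 n, hD'f, hf'.2 n]
    by_cases h2n : 2 ∣ n
    · have h0 : W.LFunction n = 0 :=
        W.LFunction_apply_eq_zero_of_not_good_of_not_mult 2 hadd.1 hadd.2 h2n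
      rw [h0, hχeven n h2n]
      simp
    · have hLn' : W.LFunction n = (W'.quadraticTwist (d : ℚ)).LFunction n := by rw [hLtw]
      rw [hLn', hχodd n h2n]
  -- the `Γ₀` twist step: `c(D) ∣ c(D')`
  have hdvd : D.c ∣ D'.c := maninConstant_dvd_of_charTwist_gamma0 D' D hopt hχq hχp hN'N hmN hf hC hLC
  have hD' : ¬ p ∣ D'.maninConstant := hp W₁' D' hiso' hopt'
  exact fun h ↦ hD' (h.trans hdvd)

/-- **Transport of `p ∤ c` down a dyadic `η = 1` untwist (any prime `p`)**, granted modularity: `W`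
globally minimal with a lattice-optimal `X₀(N)`-datum `D`, `4 ∣ N`, `W ∼ W' ⊗ ℚ(√d)`, `d ∈ {−1, 2, −2}`,
`W'` globally minimal with `4 ∤ N(W')`, and `d = −1` or `2 ∣ N(W')` (Stevens' `η = 1`). If every
lattice-optimal datum on the class of `W'` has Manin constant prime to `p`, so has `D`. Side conditions
(`N(W') ∣ N`, `(4|d|)² ∣ N`, additivity) by the landed `stub_dyadicTwistConductor`; characters
`χ₋₄, χ₈, χ₋₈` as in the tree. [cite: Stevens1989, Lemmas (5.2), (5.4)] [cite: Pal2012, Lemma 3.1] -/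
theorem maninLocalTwoThree_not_dvd_maninConstant_of_dyadicUntwist
    (hnf : exists_isNewformOf)
    {W : WeierstrassCurve ℚ} [W.IsElliptic] [W.IsGloballyMinimal] {N : ℕ} [NeZero N]
    (D : ModularParametrizationData W N)
    (hopt : ∀ z ∈ D.L.lattice, ∃ w ∈ periodLattice D.f, z = D.c * w) (h4 : 2 ^ 2 ∣ N)
    {W' : WeierstrassCurve ℚ} [W'.IsElliptic] [W'.IsGloballyMinimal]
    {d : ℤ} (hd : d = -1 ∨ d = 2 ∨ d = -2) (htw : IsIsogenous W (W'.quadraticTwist (d : ℚ)))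
    (h4N' : ¬ 2 ^ 2 ∣ W'.conductorNorm ℤ) (hη : d = -1 ∨ 2 ∣ W'.conductorNorm ℤ) {p : ℤ}
    (hp : ∀ (W₁ : WeierstrassCurve ℚ) [W₁.IsElliptic] [W₁.IsGloballyMinimal] {N₁ : ℕ} [NeZero N₁]
      (D₁ : ModularParametrizationData W₁ N₁), IsIsogenous W' W₁ →
      (∀ z ∈ D₁.L.lattice, ∃ w ∈ periodLattice D₁.f, z = D₁.c * w) → ¬ p ∣ D₁.maninConstant) :
    ¬ p ∣ D.maninConstant := by
  haveI : Fact (Nat.Prime 2) := ⟨Nat.prime_two⟩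
  have hN : N = W.conductorNorm ℤ :=
    IsNewformOf.level_eq_conductorNorm_of_exists_isNewformOf hnf D.isNewformOf
  have hadd : ¬ W.HasGoodReductionAtPrime 2 ∧ ¬ W.HasMultiplicativeReductionAtPrime 2 :=
    Summit.BirchSwinnertonDyer.Rank1Residual.ManinAdditive.not_good_and_not_mult_of_sq_dvd_conductorNorm
      W (hN ▸ h4)
  obtain ⟨hN'N, hmN⟩ := stub_dyadicTwistConductor hnf hd htw h4N' hadd
  rw [← hN] at hN'N hmN
  rcases hd with rfl | rfl | rfl
  · refine maninLocalTwoThree_not_dvd_maninConstant_of_dyadicUntwist_of_char hnf D hopt (d := -1)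
      (Or.inl rfl) isQuadratic_χ₄_ringHomComp isPrimitive_χ₄_ringHomComp
      (by rw [gaussSum_χ₄_ringHomComp_sq]; norm_num) (fun n hn ↦ ?_) (fun n hn ↦ ?_) htw hN'N
      (by simpa using hmN) h4N' hη hadd hp
    · rw [show ((-1 : ℤ) : ℚ) = -1 by norm_num, W'.LFunction_quadraticTwist_neg_one_apply_of_odd hn,
        Int.cast_mul, χ₄_ringHomComp_apply_natCast]
    · rw [χ₄_ringHomComp_apply_natCast, ZMod.χ₄_nat_eq_if_mod_four, if_pos (Nat.mod_eq_zero_of_dvd hn)]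
      simp
  · refine maninLocalTwoThree_not_dvd_maninConstant_of_dyadicUntwist_of_char hnf D hopt (d := 2)
      (Or.inr (Or.inl rfl)) isQuadratic_χ₈_ringHomComp isPrimitive_χ₈_ringHomComp
      (by rw [gaussSum_χ₈_ringHomComp_sq]; norm_num) (fun n hn ↦ ?_) (fun n hn ↦ ?_) htw hN'N
      (by simpa using hmN) h4N' hη hadd hp
    · rw [show ((2 : ℤ) : ℚ) = 2 by norm_num, W'.LFunction_quadraticTwist_two_apply_of_odd hn,
        Int.cast_mul, χ₈_ringHomComp_apply_natCast]
    · rw [χ₈_ringHomComp_apply_natCast, ZMod.χ₈_nat_eq_if_mod_eight,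
        if_pos (Nat.mod_eq_zero_of_dvd hn)]
      simp
  · refine maninLocalTwoThree_not_dvd_maninConstant_of_dyadicUntwist_of_char hnf D hopt (d := -2)
      (Or.inr (Or.inr rfl)) isQuadratic_χ₈'_ringHomComp isPrimitive_χ₈'_ringHomComp
      (by rw [gaussSum_χ₈'_ringHomComp_sq]; norm_num) (fun n hn ↦ ?_) (fun n hn ↦ ?_) htw hN'N
      (by simpa using hmN) h4N' hη hadd hp
    · rw [show ((-2 : ℤ) : ℚ) = -2 by norm_num, W'.LFunction_quadraticTwist_neg_two_apply_of_odd hn,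
        Int.cast_mul, χ₈'_ringHomComp_apply_natCast]
    · rw [χ₈'_ringHomComp_apply_natCast, ZMod.χ₈'_nat_eq_if_mod_eight,
        if_pos (Nat.mod_eq_zero_of_dvd hn)]
      simp

/-! ## §2 C3 ⟸ its fully twist-minimal core -/

/-- **The birth stub `stub_twistMinimalAtThree` of C3 ⟸ its FULLY twist-minimal core**: the stub
(verbatim as the conclusion) follows from its restriction to the classes that admit no ternary untwist
(the stub's own hypothesis), no odd semistable untwist at `q ≠ 3` with `q² ∣ N`, AND no dyadic `η = 1`
semistable untwist (`4 ∣ N`, `W ∼ W' ⊗ ℚ(√d)`, `d ∈ {−1, 2, −2}`, `4 ∤ N(W')`, `d = −1 ∨ 2 ∣ N(W')`).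
Strong induction on the level with the two transport lemmas at `p = 3`
(`maninLocalTwoThree_not_dvd_maninConstant_of_oddUntwist`, `…_of_dyadicUntwist`); the partner class has
smaller conductor, keeps `9 ∣ N` and ternary twist-minimality (`χ_{q*}`, `χ_d` are unramified at `3`).
[cite: Stevens1989, Lemmas (5.2), (5.4)] [cite: SilvermanATAEC1994, IV.9.4] -/
theorem maninLocalTwoThree_twistMinimalAtThree_of_fullUntwistMinimal
    (H : Literature.NumberTheory.EllipticCurves.ModularForms.mazur_not_dvd_maninConstant_of_odd →
      Literature.NumberTheory.EllipticCurves.ModularForms.abbesUllmo_not_dvd_maninConstant_of_not_dvd_level →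
      Literature.NumberTheory.EllipticCurves.ModularForms.cesnavicius_not_two_dvd_maninConstant_of_two_dvd_level →
      Literature.NumberTheory.EllipticCurves.ModularForms.exists_isNewformOf →
      ∀ (W : WeierstrassCurve ℚ) [W.IsElliptic] [W.IsGloballyMinimal] {N : ℕ} [NeZero N]
        (D : ModularParametrizationData W N),
        (∀ z ∈ D.L.lattice, ∃ w ∈ periodLattice D.f, z = D.c * w) → 3 ^ 2 ∣ N →
        ¬ (∃ (W' : WeierstrassCurve ℚ) (d : ℤ), W'.IsElliptic ∧ W'.IsGloballyMinimal ∧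
          (d = -3) ∧ IsIsogenous W (W'.quadraticTwist (d : ℚ)) ∧
          ¬ 3 ^ 2 ∣ W'.conductorNorm ℤ) →
        ¬ (∃ (W' : WeierstrassCurve ℚ) (q : ℕ), W'.IsElliptic ∧ W'.IsGloballyMinimal ∧
          q.Prime ∧ q ≠ 2 ∧ q ≠ 3 ∧ q ^ 2 ∣ N ∧
          IsIsogenous W (W'.quadraticTwist (((-1 : ℤ) ^ (q / 2) * q : ℤ) : ℚ)) ∧
          ¬ q ^ 2 ∣ W'.conductorNorm ℤ) →
        ¬ (∃ (W' : WeierstrassCurve ℚ) (d : ℤ), W'.IsElliptic ∧ W'.IsGloballyMinimal ∧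
          (d = -1 ∨ d = 2 ∨ d = -2) ∧ 2 ^ 2 ∣ N ∧ IsIsogenous W (W'.quadraticTwist (d : ℚ)) ∧
          ¬ 2 ^ 2 ∣ W'.conductorNorm ℤ ∧ (d = -1 ∨ 2 ∣ W'.conductorNorm ℤ)) →
        ¬ (3 : ℤ) ∣ D.maninConstant) :
    Literature.NumberTheory.EllipticCurves.ModularForms.mazur_not_dvd_maninConstant_of_odd →
    Literature.NumberTheory.EllipticCurves.ModularForms.abbesUllmo_not_dvd_maninConstant_of_not_dvd_level →
    Literature.NumberTheory.EllipticCurves.ModularForms.cesnavicius_not_two_dvd_maninConstant_of_two_dvd_level →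
    Literature.NumberTheory.EllipticCurves.ModularForms.exists_isNewformOf →
    ∀ (W : WeierstrassCurve ℚ) [W.IsElliptic] [W.IsGloballyMinimal] {N : ℕ} [NeZero N]
      (D : ModularParametrizationData W N),
      (∀ z ∈ D.L.lattice, ∃ w ∈ periodLattice D.f, z = D.c * w) → 3 ^ 2 ∣ N →
      ¬ (∃ (W' : WeierstrassCurve ℚ) (d : ℤ), W'.IsElliptic ∧ W'.IsGloballyMinimal ∧
        (d = -3) ∧ IsIsogenous W (W'.quadraticTwist (d : ℚ)) ∧
        ¬ 3 ^ 2 ∣ W'.conductorNorm ℤ) →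
      ¬ (3 : ℤ) ∣ D.maninConstant := by
  intro hM hAU hC2 hnf
  have hmod : nonempty_modularParametrizationData :=
    maninLocalTwoThree_nonempty_modularParametrizationData_of_exists_isNewformOf hnf
  -- ternary twist-minimality is inherited along any untwist unramified at `3`
  have inherit : ∀ {W W' W₁ V : WeierstrassCurve ℚ} [W.IsElliptic] [W'.IsElliptic] [W₁.IsElliptic]
      [V.IsElliptic] [V.IsGloballyMinimal] {e : ℤ} (he0 : (e : ℚ) ≠ 0)
      (hfe : ∀ (X : WeierstrassCurve ℚ) [X.IsElliptic],
        (X.quadraticTwist (e : ℚ)).conductorExponent ((primesEquiv (R := ℤ)).symm ⟨3, Nat.prime_three⟩) =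
          X.conductorExponent ((primesEquiv (R := ℤ)).symm ⟨3, Nat.prime_three⟩)),
      IsIsogenous W (W'.quadraticTwist (e : ℚ)) → IsIsogenous W' W₁ →
      IsIsogenous W₁ (V.quadraticTwist ((-3 : ℤ) : ℚ)) → ¬ 3 ^ 2 ∣ V.conductorNorm ℤ →
      ∃ (V₂ : WeierstrassCurve ℚ) (d : ℤ), V₂.IsElliptic ∧ V₂.IsGloballyMinimal ∧ (d = -3) ∧
        IsIsogenous W (V₂.quadraticTwist (d : ℚ)) ∧ ¬ 3 ^ 2 ∣ V₂.conductorNorm ℤ := by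
    intro W W' W₁ V _ _ _ _ _ e he0 hfe htw hiso₁ hisoV h9V
    have hdq : ((-3 : ℤ) : ℚ) ≠ 0 := by norm_num
    haveI : (V.quadraticTwist ((-3 : ℤ) : ℚ)).IsElliptic := V.isElliptic_quadraticTwist hdq
    haveI : (V.quadraticTwist (e : ℚ)).IsElliptic := V.isElliptic_quadraticTwist he0
    haveI : (W'.quadraticTwist (e : ℚ)).IsElliptic := W'.isElliptic_quadraticTwist he0
    obtain ⟨C, hCmin⟩ := hasGlobalMinimalModel_rat_holds (V.quadraticTwist (e : ℚ))
    haveI := hCmin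
    refine ⟨C • V.quadraticTwist (e : ℚ), -3, inferInstance, hCmin, rfl, ?_, ?_⟩
    · have h1 : IsIsogenous W' (V.quadraticTwist ((-3 : ℤ) : ℚ)) := hiso₁.trans' hisoV
      have h2 : IsIsogenous (W'.quadraticTwist (e : ℚ))
          ((V.quadraticTwist ((-3 : ℤ) : ℚ)).quadraticTwist (e : ℚ)) := h1.quadraticTwist he0
      rw [quadraticTwist_quadraticTwist, mul_comm ((-3 : ℤ) : ℚ) (e : ℚ),
        ← quadraticTwist_quadraticTwist] at h2
      have h3 : IsIsogenous ((V.quadraticTwist (e : ℚ)).quadraticTwist ((-3 : ℤ) : ℚ))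
          ((C • V.quadraticTwist (e : ℚ)).quadraticTwist ((-3 : ℤ) : ℚ)) := by
        rw [quadraticTwist_smul]; exact isIsogenous_smul _ _
      exact (htw.trans' h2).trans' h3
    · rw [conductorNorm_smul_rat]
      intro h9V₂
      apply h9V
      have e1 := factorization_conductorNorm_primesEquiv_symm V ⟨3, Nat.prime_three⟩
      have e2 := factorization_conductorNorm_primesEquiv_symm (V.quadraticTwist (e : ℚ)) ⟨3, Nat.prime_three⟩
      simp only at e1 e2
      refine (Nat.prime_three.pow_dvd_iff_le_factorization (conductorNorm_pos_holds V).ne').mpr ?_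
      rw [e1, ← hfe V, ← e2]
      exact (Nat.prime_three.pow_dvd_iff_le_factorization (conductorNorm_pos_holds _).ne').mp h9V₂
  -- `9 ∣ N(W')` is inherited along any untwist unramified at `3`
  have nine : ∀ {W W' : WeierstrassCurve ℚ} [W.IsElliptic] [W'.IsElliptic] {e : ℤ} (he0 : (e : ℚ) ≠ 0)
      (hfe : (W'.quadraticTwist (e : ℚ)).conductorExponent ((primesEquiv (R := ℤ)).symm ⟨3, Nat.prime_three⟩) =
          W'.conductorExponent ((primesEquiv (R := ℤ)).symm ⟨3, Nat.prime_three⟩)),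
      IsIsogenous W (W'.quadraticTwist (e : ℚ)) → 3 ^ 2 ∣ W.conductorNorm ℤ →
      3 ^ 2 ∣ W'.conductorNorm ℤ := by
    intro W W' _ _ e he0 hfe htw h9
    haveI : (W'.quadraticTwist (e : ℚ)).IsElliptic := W'.isElliptic_quadraticTwist he0
    have hWV : W.conductorNorm ℤ = (W'.quadraticTwist (e : ℚ)).conductorNorm ℤ :=
      conductorNorm_eq_of_isIsogenous_of_modularity hmod _ _ htw
    have h3W : 2 ≤ (W.conductorNorm ℤ).factorization 3 :=
      (Nat.prime_three.pow_dvd_iff_le_factorization (conductorNorm_pos_holds W).ne').mp h9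
    refine (Nat.prime_three.pow_dvd_iff_le_factorization (conductorNorm_pos_holds W').ne').mpr ?_
    have e1 := factorization_conductorNorm_primesEquiv_symm (W'.quadraticTwist (e : ℚ)) ⟨3, Nat.prime_three⟩
    have e2 := factorization_conductorNorm_primesEquiv_symm W' ⟨3, Nat.prime_three⟩
    simp only at e1 e2
    rw [e2, ← hfe, ← e1, ← hWV]
    exact h3W
  suffices key : ∀ (n : ℕ) (W : WeierstrassCurve ℚ) [W.IsElliptic] [W.IsGloballyMinimal] (N : ℕ)
      [NeZero N] (D : ModularParametrizationData W N), N < n →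
      (∀ z ∈ D.L.lattice, ∃ w ∈ periodLattice D.f, z = D.c * w) → 3 ^ 2 ∣ N →
      ¬ (∃ (W' : WeierstrassCurve ℚ) (d : ℤ), W'.IsElliptic ∧ W'.IsGloballyMinimal ∧
        (d = -3) ∧ IsIsogenous W (W'.quadraticTwist (d : ℚ)) ∧
        ¬ 3 ^ 2 ∣ W'.conductorNorm ℤ) →
      ¬ (3 : ℤ) ∣ D.maninConstant by
    intro W _ _ N _ D hopt h9 hmin
    exact key (N + 1) W N D (Nat.lt_succ_self N) hopt h9 hmin
  intro n
  induction n with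
  | zero => intro W _ _ N _ D hN; exact absurd hN (Nat.not_lt_zero N)
  | succ n ih =>
    intro W _ _ N _ D hNn hopt h9 hmin
    have hN : N = W.conductorNorm ℤ :=
      IsNewformOf.level_eq_conductorNorm_of_exists_isNewformOf hnf D.isNewformOf
    have h9W : 3 ^ 2 ∣ W.conductorNorm ℤ := hN ▸ h9
    by_cases hodd : ∃ (W' : WeierstrassCurve ℚ) (q : ℕ), W'.IsElliptic ∧ W'.IsGloballyMinimal ∧
        q.Prime ∧ q ≠ 2 ∧ q ≠ 3 ∧ q ^ 2 ∣ N ∧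
        IsIsogenous W (W'.quadraticTwist (((-1 : ℤ) ^ (q / 2) * q : ℤ) : ℚ)) ∧
        ¬ q ^ 2 ∣ W'.conductorNorm ℤ
    · obtain ⟨W', q, hE', hM', hqp, hq2, hq3, hqN, htw, hqN'⟩ := hodd
      haveI := hE'
      haveI := hM'
      haveI : Fact q.Prime := ⟨hqp⟩
      refine maninLocalTwoThree_not_dvd_maninConstant_of_oddUntwist hnf hq2 D hopt hqN htw hqN' ?_
      intro W₁ _ _ N₁ _ D₁ hiso₁ hopt₁
      have hd0 : ((((-1 : ℤ) ^ (q / 2) * q : ℤ)) : ℚ) ≠ 0 := by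
        push_cast
        exact mul_ne_zero (pow_ne_zero _ (by norm_num)) (by exact_mod_cast hqp.ne_zero)
      have hv3 : natGenerator ((primesEquiv (R := ℤ)).symm ⟨3, Nat.prime_three⟩) ≠ q := by
        rw [natGenerator_primesEquiv_symm Nat.prime_three]; exact fun h ↦ hq3 h.symm
      have hfe : ∀ (X : WeierstrassCurve ℚ) [X.IsElliptic],
          (X.quadraticTwist ((((-1 : ℤ) ^ (q / 2) * q : ℤ)) : ℚ)).conductorExponent
              ((primesEquiv (R := ℤ)).symm ⟨3, Nat.prime_three⟩) =
            X.conductorExponent ((primesEquiv (R := ℤ)).symm ⟨3, Nat.prime_three⟩) := by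
        intro X _
        haveI : (X.quadraticTwist (((-1 : ℤ) ^ (q / 2) * q : ℤ) : ℚ)).IsElliptic :=
          X.isElliptic_quadraticTwist hd0
        have hC1 : (1 : VariableChange ℚ) • X.quadraticTwist ((-1 : ℚ) ^ (q / 2) * q) =
            X.quadraticTwist (((-1 : ℤ) ^ (q / 2) * q : ℤ) : ℚ) := by
          rw [one_smul]; push_cast; rfl
        exact Summit.BirchSwinnertonDyer.Rank1Residual.Additive.conductorExponent_eq_of_twist_pStar_of_ne
          q hq2 X _ 1 hC1 _ hv3
      have hN₁ : N₁ = W'.conductorNorm ℤ := level_eq_conductorNorm_of_isIsogenous hnf D₁ hiso₁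
      have hadd : ¬ W.HasGoodReductionAtPrime q ∧ ¬ W.HasMultiplicativeReductionAtPrime q :=
        Summit.BirchSwinnertonDyer.Rank1Residual.ManinAdditive.not_good_and_not_mult_of_sq_dvd_conductorNorm
          W (hN ▸ hqN)
      have hN'N : W'.conductorNorm ℤ ∣ W.conductorNorm ℤ :=
        maninLocalTwoThree_conductorNorm_dvd_of_isIsogenous_twist_pStar hnf hq2 htw hqN' hadd
      have hlt : N₁ < N := by
        rw [hN₁, hN]
        refine lt_of_le_of_ne (Nat.le_of_dvd (conductorNorm_pos_holds W) hN'N) fun h ↦ hqN' ?_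
        rw [h]; exact hN ▸ hqN
      have h9₁ : 3 ^ 2 ∣ N₁ := hN₁ ▸ nine hd0 (hfe W') htw h9W
      refine ih W₁ N₁ D₁ (by omega) hopt₁ h9₁ ?_
      rintro ⟨V, d, hVe, hVm, rfl, hisoV, h9V⟩
      haveI := hVe
      haveI := hVm
      exact hmin (inherit hd0 hfe htw hiso₁ hisoV h9V)
    · by_cases hdy : ∃ (W' : WeierstrassCurve ℚ) (d : ℤ), W'.IsElliptic ∧ W'.IsGloballyMinimal ∧
          (d = -1 ∨ d = 2 ∨ d = -2) ∧ 2 ^ 2 ∣ N ∧ IsIsogenous W (W'.quadraticTwist (d : ℚ)) ∧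
          ¬ 2 ^ 2 ∣ W'.conductorNorm ℤ ∧ (d = -1 ∨ 2 ∣ W'.conductorNorm ℤ)
      · obtain ⟨W', d, hE', hM', hd, h4, htw, h4N', hη⟩ := hdy
        haveI := hE'
        haveI := hM'
        haveI : Fact (Nat.Prime 2) := ⟨Nat.prime_two⟩
        refine maninLocalTwoThree_not_dvd_maninConstant_of_dyadicUntwist hnf D hopt h4 hd htw h4N' hη ?_
        intro W₁ _ _ N₁ _ D₁ hiso₁ hopt₁
        have hdne : d ≠ 0 := by rcases hd with rfl | rfl | rfl <;> norm_num
        have hd0 : (d : ℚ) ≠ 0 := by exact_mod_cast hdne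
        have hfe : ∀ (X : WeierstrassCurve ℚ) [X.IsElliptic],
            (X.quadraticTwist (d : ℚ)).conductorExponent ((primesEquiv (R := ℤ)).symm ⟨3, Nat.prime_three⟩) =
              X.conductorExponent ((primesEquiv (R := ℤ)).symm ⟨3, Nat.prime_three⟩) := fun X _ ↦
          maninLocalTwoThree_conductorExponent_quadraticTwist_eq_of_ne_two X hd _
            (by rw [natGenerator_primesEquiv_symm Nat.prime_three]; norm_num)
        have hN₁ : N₁ = W'.conductorNorm ℤ := level_eq_conductorNorm_of_isIsogenous hnf D₁ hiso₁
        have hadd : ¬ W.HasGoodReductionAtPrime 2 ∧ ¬ W.HasMultiplicativeReductionAtPrime 2 :=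
          Summit.BirchSwinnertonDyer.Rank1Residual.ManinAdditive.not_good_and_not_mult_of_sq_dvd_conductorNorm
            W (hN ▸ h4)
        have hN'N : W'.conductorNorm ℤ ∣ W.conductorNorm ℤ :=
          (stub_dyadicTwistConductor hnf hd htw h4N' hadd).1
        have hlt : N₁ < N := by
          rw [hN₁, hN]
          refine lt_of_le_of_ne (Nat.le_of_dvd (conductorNorm_pos_holds W) hN'N) fun h ↦ h4N' ?_
          rw [h]; exact hN ▸ h4
        have h9₁ : 3 ^ 2 ∣ N₁ := hN₁ ▸ nine hd0 (hfe W') htw h9W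
        refine ih W₁ N₁ D₁ (by omega) hopt₁ h9₁ ?_
        rintro ⟨V, d', hVe, hVm, rfl, hisoV, h9V⟩
        haveI := hVe
        haveI := hVm
        exact hmin (inherit hd0 hfe htw hiso₁ hisoV h9V)
      · exact H hM hAU hC2 hnf W D hopt h9 hmin hodd hdy

/-- **Crux C3 `ManinPrimeToThreeAtNine` ⟸ its fully twist-minimal core** (one hypothesis): Manin's
conjecture at `3`, modulo the printed facts, for the optimal curves with `9 ∣ N` admitting no ternary, no
odd (`q ≠ 3`, `q² ∣ N`) and no dyadic `η = 1` semistable untwist. [cite: Stevens1989, Lemmas (5.2), (5.4)]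
[cite: Cesnavicius2018, Thm. 1.2] -/
theorem maninLocalTwoThree_maninPrimeToThreeAtNine_of_fullUntwistMinimal
    (H : Literature.NumberTheory.EllipticCurves.ModularForms.mazur_not_dvd_maninConstant_of_odd →
      Literature.NumberTheory.EllipticCurves.ModularForms.abbesUllmo_not_dvd_maninConstant_of_not_dvd_level →
      Literature.NumberTheory.EllipticCurves.ModularForms.cesnavicius_not_two_dvd_maninConstant_of_two_dvd_level →
      Literature.NumberTheory.EllipticCurves.ModularForms.exists_isNewformOf →
      ∀ (W : WeierstrassCurve ℚ) [W.IsElliptic] [W.IsGloballyMinimal] {N : ℕ} [NeZero N]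
        (D : ModularParametrizationData W N),
        (∀ z ∈ D.L.lattice, ∃ w ∈ periodLattice D.f, z = D.c * w) → 3 ^ 2 ∣ N →
        ¬ (∃ (W' : WeierstrassCurve ℚ) (d : ℤ), W'.IsElliptic ∧ W'.IsGloballyMinimal ∧
          (d = -3) ∧ IsIsogenous W (W'.quadraticTwist (d : ℚ)) ∧
          ¬ 3 ^ 2 ∣ W'.conductorNorm ℤ) →
        ¬ (∃ (W' : WeierstrassCurve ℚ) (q : ℕ), W'.IsElliptic ∧ W'.IsGloballyMinimal ∧
          q.Prime ∧ q ≠ 2 ∧ q ≠ 3 ∧ q ^ 2 ∣ N ∧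
          IsIsogenous W (W'.quadraticTwist (((-1 : ℤ) ^ (q / 2) * q : ℤ) : ℚ)) ∧
          ¬ q ^ 2 ∣ W'.conductorNorm ℤ) →
        ¬ (∃ (W' : WeierstrassCurve ℚ) (d : ℤ), W'.IsElliptic ∧ W'.IsGloballyMinimal ∧
          (d = -1 ∨ d = 2 ∨ d = -2) ∧ 2 ^ 2 ∣ N ∧ IsIsogenous W (W'.quadraticTwist (d : ℚ)) ∧
          ¬ 2 ^ 2 ∣ W'.conductorNorm ℤ ∧ (d = -1 ∨ 2 ∣ W'.conductorNorm ℤ)) →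
        ¬ (3 : ℤ) ∣ D.maninConstant) :
    Summit.BirchSwinnertonDyer.BirchSwinnertonDyer.Theses.ManinLocalTwoThree.ManinPrimeToThreeAtNine :=
  maninLocalTwoThree_maninPrimeToThreeAtNine_of_twistMinimalAtThree
    (maninLocalTwoThree_twistMinimalAtThree_of_fullUntwistMinimal H)

end Summit.BirchSwinnertonDyer.BirchSwinnertonDyer.Theorems

end
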